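/-
Copyright (c) 2026. All rights reserved.
Released under Apache 2.0 license as described in the file LICENSE.
-/
import Summits.Langlands.Langlands.Theorems.SoloInformedBmaxInvariantsInField
import HarnessLib

/-!
# `B_max(F)^{Γ_F} = K₀` conditional on Colmez's `t`-divisibility criterion (solo programme, rung Λ5)

Programme `solo-Langlands-informed`, repair of the crystalline clause D2-cris of `Summit.Langlands`
(`SpecC` = the comparison `B_max(F)^{Γ_F} = K₀ = W(k_F)[1/p]`, input (I2) of the repair).

State of the input before this file.  Λ3 (`forall_galBmax_iff_of_isPIntegral`) proves `= K₀` for the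
`p`-integral part `A_max[1/p]` of the constructed `B_max(F) = A_max[1/t]` (`D2Cris.Bmax F p`), and Λ4
(`forall_galBmax_iff_mem_range`, `exists_field_mul_tBdR_pow_of_twisted`) bounds ALL invariants by `F` inside
`B_dR(F)`.  What is missing is a statement forcing an invariant `y = a/tᵏ` to be `p`-integral.

This file isolates that missing statement as a classical, Galois-free fact about the period ring `A_max`
alone — **Colmez's `t`-divisibility criterion**

  (TC) `x ∈ A_max`, `θ(φⁿ x) = 0` for all `n ≥ 0` ⟹ `pᵐ x ∈ t · A_max` for some `m`

(the binder `hTC` below; Colmez, Ann. of Math. 148 (1998) §III.2–III.3: "`x ∈ B_max⁺` is divisible by `t` iff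
`θ(φⁿ(x)) = 0` for all `n ∈ ℕ`"; Fontaine, Astérisque 223, Exp. II Th. 5.3.7 (i) for `B_cris⁺`; the power `pᵐ`
is the price of working in `A_max` rather than `B_max⁺ = A_max[1/p]`) — and proves

* `forall_galBmax_iff_of_tCriterion` ★ : assuming (TC), an element of `B_max(F) = A_max[1/t]` is
  `Γ_F`-invariant iff it is `p⁻ⁿ ι(z)` with `z ∈ W(k̄)^{Γ_F} = W(k_F)`, i.e. **`B_max(F)^{Γ_F} = K₀`**;
* `exists_mul_pow_eq_algebraMap_of_forall_galBmax` : assuming (TC), every `Γ_F`-invariant of `A_max[1/t]`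
  is `p`-integral up to a power of `p` (the hypothesis `hint` of Λ3).

Mechanism (the twisted layers).  Write an invariant as `y = a/tᵏ`; then `a` is `χᵏ`-twisted
(`σ a = ι(χ(σ))ᵏ a` for all `σ`, `twisted_of_forall_galBmax`).  By Λ4, a `χᵏ`-twisted `a` with `k ≥ 1` is
`c · t_dRᵏ` in `B_dR(F)` (`c ∈ F`), so `θ(a) = 0` (`thetaBmaxPlus_eq_zero_of_twisted`); twistedness is `φ`-stable
(`φ` commutes with `Γ_F` and fixes `ι(ℤ_p)`), so `θ(φⁿ a) = 0` for all `n`, and (TC) gives `pᵐ a = t a₁`;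
`t`-regularity of `A_max` (`eq_zero_of_tBmax_mul_eq_zero`) makes `a₁` `χᵏ⁻¹`-twisted (`twisted_descend`).  Induction
on `k` (`exists_tBmax_pow_mul_of_twisted`) gives `pᵐ a = tᵏ b` with `b ∈ A_max^{Γ_F}`, whence `y pᵐ = b` is
`p`-integral and Λ3 applies.

After this file input (I2) of the D2-cris repair is re-costed to (TC), a `φ/θ`-statement about `A_max` with
no Galois action and no dependence on `F` beyond `ℂ_F` (the tree already has the `φ = p` eigen-case,
`exists_sq_mul_eq_zpToAinf_mul_tBmax'`).

References: Colmez, Ann. of Math. 148 (1998), §III.2–III.3; Fontaine, Astérisque 223 (1994), Exp. II §5.3,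
Exp. III §4.1.
-/

noncomputable section

open WittVector Field IsLocalRing ValuativeRel
open Literature.NumberTheory.GaloisRepresentations Literature.NumberTheory.PAdicHodge
open Literature.NumberTheory.GaloisRepresentations.IsNonarchimedeanLocalField

namespace Summit.Langlands.Langlands.Theorems

namespace SpecC

variable {F : Type} [Field F] [ValuativeRel F] [TopologicalSpace F] [IsNonarchimedeanLocalField F] [CharZero F]
  {p : ℕ} [Fact p.Prime] [Fact (¬ IsUnit (p : integerC F))] [IsAdicComplete (Ideal.span {(p : integerC F)}) (integerC F)]

/-! ### §1 The scalar `ι(χ(σ))` and the hypotheses -/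

variable (F p) in
/-- The scalar `ι(χ(σ)) ∈ A_max` (`χ` the cyclotomic character, `ι : ℤ_p → 𝔸_inf → A_max`), by which `σ` multiplies `t`.
[cite: FontaineAsterisque223III, Exp. II §1.5.4] -/
def chiAmax (σ : absoluteGaloisGroup F) : BmaxPlus F p :=
  ainfToBmaxPlus F p (zpToAinf ((GaloisRep.cyclotomicCharacter F p σ : ℤ_[p]ˣ) : ℤ_[p]))

/-- `σ t = ι(χ(σ)) · t` (tree `galBmaxPlus_tBmax`). [cite: FontaineAsterisque223III, Exp. II §1.5.4] -/
theorem galBmaxPlus_tBmax_eq_chiAmax_mul (σ : absoluteGaloisGroup F) :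
    galBmaxPlus σ (tBmax (F := F) (p := p)) = chiAmax F p σ * tBmax :=
  galBmaxPlus_tBmax σ

omit [CharZero F] [IsAdicComplete (Ideal.span {(p : integerC F)}) (integerC F)] in
/-- `ι(χ(σ))` is a unit of `A_max`. [folklore] -/
theorem isUnit_chiAmax (σ : absoluteGaloisGroup F) : IsUnit (chiAmax F p σ) :=
  ((GaloisRep.cyclotomicCharacter F p σ).isUnit.map zpToAinf).map (ainfToBmaxPlus F p)

omit [CharZero F] [IsAdicComplete (Ideal.span {(p : integerC F)}) (integerC F)] in
/-- `φ` fixes `ι(χ(σ))` (`φ` fixes `ι(ℤ_p)`, tree `frobenius_zpToAinf`). [cite: FontaineOuyang2022, §4.4] -/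
theorem frobBmaxPlus_chiAmax (σ : absoluteGaloisGroup F) : frobBmaxPlus F p (chiAmax F p σ) = chiAmax F p σ := by
  unfold chiAmax
  rw [frobBmaxPlus_ainfToBmaxPlus, frobenius_zpToAinf]

/-! The standing hypotheses of the file: `hp` (`p` is not a unit of `𝒪_F`, i.e. `F/ℚ_p`), `hF` (Fontaine's `θ` is onto `𝒪_{ℂ_F}`),
and **(TC) = `hTC`, Colmez's `t`-divisibility criterion for `A_max`**: an element `x ∈ A_max` killed by `θ ∘ φⁿ` for every
`n ≥ 0` is divisible by `t` in `A_max` up to a power of `p` (`pᵐ x = t · y`).  (TC) is a published theorem about the period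
ring alone (Colmez, Ann. of Math. 148 (1998) §III.2–III.3; Fontaine, Astérisque 223, Exp. II Th. 5.3.7 (i) for `B_cris⁺`),
not yet in the tree; it enters the theorems below as an explicit binder. -/

variable (hp : valuation F p < 1) (hF : Function.Surjective (fontaineTheta (integerC F) p))
  (hTC : ∀ x : BmaxPlus F p, (∀ n : ℕ, thetaBmaxPlus F p ((frobBmaxPlus F p)^[n] x) = 0) →
    ∃ (m : ℕ) (y : BmaxPlus F p), (p : BmaxPlus F p) ^ m * x = tBmax * y)

/-! ### §2 `χᵏ`-twisted elements of `A_max`: `σ a = ι(χ(σ))ᵏ · a` for all `σ ∈ Γ_F` -/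

/-- `tᵏ` is `χᵏ`-twisted. [cite: FontaineAsterisque223III, Exp. II §1.5.4] -/
theorem galBmaxPlus_tBmax_pow (k : ℕ) (σ : absoluteGaloisGroup F) :
    galBmaxPlus σ (tBmax (F := F) (p := p) ^ k) = chiAmax F p σ ^ k * tBmax ^ k := by
  rw [map_pow, galBmaxPlus_tBmax_eq_chiAmax_mul, mul_pow]

/-- **Twistedness is `φ`-stable** (`φ` commutes with `Γ_F` and fixes `ι(ℤ_p)`): if `a` is `χᵏ`-twisted, so is `φ a`.
[cite: Colmez1998Annals, §III.2] -/
theorem galBmaxPlus_frobBmaxPlus_of_twisted {k : ℕ} {a : BmaxPlus F p}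
    (h : ∀ σ : absoluteGaloisGroup F, galBmaxPlus σ a = chiAmax F p σ ^ k * a) (σ : absoluteGaloisGroup F) :
    galBmaxPlus σ (frobBmaxPlus F p a) = chiAmax F p σ ^ k * frobBmaxPlus F p a := by
  simp only [galBmaxPlus_frobBmaxPlus, h σ, map_mul, map_pow, frobBmaxPlus_chiAmax]

/-- Iterated form: `φⁿ a` is `χᵏ`-twisted if `a` is. [cite: Colmez1998Annals, §III.2] -/
theorem galBmaxPlus_frobBmaxPlus_iterate_of_twisted {k : ℕ} {a : BmaxPlus F p}
    (h : ∀ σ : absoluteGaloisGroup F, galBmaxPlus σ a = chiAmax F p σ ^ k * a) (n : ℕ) (σ : absoluteGaloisGroup F) :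
    galBmaxPlus σ ((frobBmaxPlus F p)^[n] a) = chiAmax F p σ ^ k * (frobBmaxPlus F p)^[n] a := by
  induction n generalizing σ with
  | zero => exact h σ
  | succ n ih =>
    rw [Function.iterate_succ_apply']
    exact galBmaxPlus_frobBmaxPlus_of_twisted ih σ

/-- Product form of twistedness, as used by Λ4: `σ a · tᵏ = a · (σ t)ᵏ`. [folklore] -/
theorem mul_tBmax_pow_of_twisted {k : ℕ} {a : BmaxPlus F p}
    (h : ∀ σ : absoluteGaloisGroup F, galBmaxPlus σ a = chiAmax F p σ ^ k * a) (σ : absoluteGaloisGroup F) :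
    galBmaxPlus σ a * tBmax ^ k = a * galBmaxPlus σ tBmax ^ k := by
  simp only [h σ, galBmaxPlus_tBmax_eq_chiAmax_mul, mul_pow]
  ring

include hF in
/-- **Descent of the twist along `pᵐ a = t · a₁`**: if `a` is `χᵏ⁺¹`-twisted then `a₁` is `χᵏ`-twisted (`t` is a
non-zero-divisor of `A_max`, `eq_zero_of_tBmax_mul_eq_zero`, and `ι(χ(σ))` is a unit). [cite: Colmez1998Annals, §III.2] -/
theorem twisted_descend {k : ℕ} {a a₁ : BmaxPlus F p} {m : ℕ}
    (h : ∀ σ : absoluteGaloisGroup F, galBmaxPlus σ a = chiAmax F p σ ^ (k + 1) * a)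
    (hx : (p : BmaxPlus F p) ^ m * a = tBmax * a₁) (σ : absoluteGaloisGroup F) :
    galBmaxPlus σ a₁ = chiAmax F p σ ^ k * a₁ := by
  have e1 := congrArg (galBmaxPlus (F := F) (p := p) σ) hx
  simp only [map_mul, map_pow, map_natCast, h σ, galBmaxPlus_tBmax_eq_chiAmax_mul] at e1
  -- `e1 : pᵐ · (χᵏ⁺¹ a) = (χ t) · σ a₁`
  have e2 : tBmax * (chiAmax F p σ * galBmaxPlus σ a₁ - chiAmax F p σ * (chiAmax F p σ ^ k * a₁)) = 0 := by
    linear_combination (-1 : BmaxPlus F p) * e1 + chiAmax F p σ ^ (k + 1) * hx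
  exact (isUnit_chiAmax σ).mul_right_inj.1 (sub_eq_zero.1 (eq_zero_of_tBmax_mul_eq_zero hF e2))

include hp hF in
/-- **`θ` kills the twisted layers**: a `χᵏ`-twisted `a ∈ A_max` with `k ≥ 1` has `θ(a) = 0` — by Λ4 `a = c · t_dRᵏ` in
`B_dR(F)` with `c ∈ F`, and `θ_dR(t_dR) = 0`, `θ_dR ∘ (A_max → B_dR⁺) = θ`. [cite: FontaineAsterisque223III, Exp. III §4.1]
[cite: Colmez1998Annals, §III.2] -/
theorem thetaBmaxPlus_eq_zero_of_twisted {k : ℕ} {a : BmaxPlus F p}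
    (h : ∀ σ : absoluteGaloisGroup F, galBmaxPlus σ a = chiAmax F p σ ^ k * a) (hk : k ≠ 0) :
    thetaBmaxPlus F p a = 0 := by
  obtain ⟨c, hc⟩ := exists_field_mul_tBdR_pow_of_twisted hp hF (fun σ => mul_tBmax_pow_of_twisted h σ)
  have h1 : bmaxPlusToBdR F p a = embBdRHom hp hF c * tBdR ^ k := by
    apply algebraMap_fracBdR_injective (F := F) (p := p)
    simpa only [map_mul, map_pow] using hc
  have h2 : thetaBdR (bmaxPlusToBdR F p a) = 0 := by
    simp only [h1, map_mul, map_pow, thetaBdR_eq_zero_of_mem_span (tBdR_mem_span_xiBdR (F := F) (p := p)),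
      zero_pow hk, mul_zero]
  rw [thetaBdR_bmaxPlusToBdR] at h2
  exact_mod_cast h2

include hp hF in
/-- Hence `θ(φⁿ a) = 0` for every `n` (twistedness is `φ`-stable): the hypothesis of (TC). [cite: Colmez1998Annals, §III.2] -/
theorem thetaBmaxPlus_frobBmaxPlus_iterate_eq_zero_of_twisted {k : ℕ} {a : BmaxPlus F p}
    (h : ∀ σ : absoluteGaloisGroup F, galBmaxPlus σ a = chiAmax F p σ ^ k * a) (hk : k ≠ 0) (n : ℕ) :
    thetaBmaxPlus F p ((frobBmaxPlus F p)^[n] a) = 0 :=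
  thetaBmaxPlus_eq_zero_of_twisted hp hF (galBmaxPlus_frobBmaxPlus_iterate_of_twisted h n) hk

include hp hF hTC in
/-- **The twisted layers are lines over the invariants, given (TC)**: a `χᵏ`-twisted `a ∈ A_max` satisfies
`pᵐ a = tᵏ · b` with `b ∈ A_max^{Γ_F}` (induction on `k`: (TC) peels off one `t`, `twisted_descend` lowers the twist).
[cite: Colmez1998Annals, §III.2–III.3] [cite: FontaineAsterisque223III, Exp. III §4.1] -/
theorem exists_tBmax_pow_mul_of_twisted {k : ℕ} {a : BmaxPlus F p}
    (h : ∀ σ : absoluteGaloisGroup F, galBmaxPlus σ a = chiAmax F p σ ^ k * a) :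
    ∃ (m : ℕ) (b : BmaxPlus F p), (∀ σ : absoluteGaloisGroup F, galBmaxPlus σ b = b) ∧
      (p : BmaxPlus F p) ^ m * a = tBmax ^ k * b := by
  induction k generalizing a with
  | zero =>
    refine ⟨0, a, fun σ => ?_, by simp only [pow_zero, one_mul]⟩
    simpa only [pow_zero, one_mul] using h σ
  | succ k ih =>
    obtain ⟨m, a₁, hx⟩ := hTC a (thetaBmaxPlus_frobBmaxPlus_iterate_eq_zero_of_twisted hp hF h k.succ_ne_zero)
    obtain ⟨m', b, hb, hx'⟩ := ih (twisted_descend hF h hx)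
    refine ⟨m' + m, b, hb, ?_⟩
    calc (p : BmaxPlus F p) ^ (m' + m) * a = (p : BmaxPlus F p) ^ m' * ((p : BmaxPlus F p) ^ m * a) := by
          rw [pow_add, mul_assoc]
      _ = (p : BmaxPlus F p) ^ m' * (tBmax * a₁) := congrArg ((p : BmaxPlus F p) ^ m' * ·) hx
      _ = tBmax * ((p : BmaxPlus F p) ^ m' * a₁) := mul_left_comm _ _ _
      _ = tBmax * (tBmax ^ k * b) := congrArg (tBmax * ·) hx'
      _ = tBmax ^ (k + 1) * b := by rw [pow_succ', mul_assoc]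

/-! ### §3 Invariants of `B_max(F) = A_max[1/t]` are `p`-integral, given (TC) -/

include hp in
/-- The numerator of an invariant is twisted: if `y · tᵏ = a` in `A_max[1/t]` with `y` `Γ_F`-invariant, then `a` is
`χᵏ`-twisted (`A_max → A_max[1/t]` is injective, `algebraMap_bmax_injective`). [cite: Colmez1998Annals, §III.2] -/
theorem twisted_of_forall_galBmax {y : D2Cris.Bmax F p} {k : ℕ} {a : BmaxPlus F p}
    (e : y * algebraMap (BmaxPlus F p) (D2Cris.Bmax F p) tBmax ^ k = algebraMap (BmaxPlus F p) (D2Cris.Bmax F p) a)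
    (hy : ∀ σ : absoluteGaloisGroup F, D2Cris.galBmax σ y = y) (σ : absoluteGaloisGroup F) :
    galBmaxPlus σ a = chiAmax F p σ ^ k * a := by
  have h1 := congrArg (D2Cris.galBmax (F := F) (p := p) σ) e
  simp only [map_mul, map_pow, D2Cris.galBmax_algebraMap, hy σ, galBmaxPlus_tBmax_eq_chiAmax_mul, mul_pow] at h1
  -- `h1 : y · (χᵏ · tᵏ) = σ a` in `A_max[1/t]`
  have h2 : algebraMap (BmaxPlus F p) (D2Cris.Bmax F p) (galBmaxPlus σ a) =
      algebraMap (BmaxPlus F p) (D2Cris.Bmax F p) (chiAmax F p σ ^ k * a) :=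
    calc algebraMap (BmaxPlus F p) (D2Cris.Bmax F p) (galBmaxPlus σ a)
          = y * (algebraMap (BmaxPlus F p) (D2Cris.Bmax F p) (chiAmax F p σ) ^ k *
              algebraMap (BmaxPlus F p) (D2Cris.Bmax F p) tBmax ^ k) := h1.symm
      _ = algebraMap (BmaxPlus F p) (D2Cris.Bmax F p) (chiAmax F p σ) ^ k *
            (y * algebraMap (BmaxPlus F p) (D2Cris.Bmax F p) tBmax ^ k) := mul_left_comm _ _ _
      _ = algebraMap (BmaxPlus F p) (D2Cris.Bmax F p) (chiAmax F p σ) ^ k *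
            algebraMap (BmaxPlus F p) (D2Cris.Bmax F p) a :=
          congrArg (algebraMap (BmaxPlus F p) (D2Cris.Bmax F p) (chiAmax F p σ) ^ k * ·) e
      _ = algebraMap (BmaxPlus F p) (D2Cris.Bmax F p) (chiAmax F p σ ^ k * a) := by
          simp only [map_mul, map_pow]
  exact algebraMap_bmax_injective hp h2

include hp hF hTC in
/-- ★ **Invariants are `p`-integral, given (TC)**: every `Γ_F`-invariant `y ∈ B_max(F) = A_max[1/t]` has `y · pᵐ ∈ A_max`
for some `m` — the hypothesis `hint` of Λ3 `forall_galBmax_iff_of_isPIntegral`. (`y = a/tᵏ`, `a` is `χᵏ`-twisted,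
`pᵐ a = tᵏ b` by `exists_tBmax_pow_mul_of_twisted`, cancel the unit `tᵏ`.) [cite: Colmez1998Annals, §III.2–III.3]
[cite: FontaineAsterisque223III, Exp. III §4.1] -/
theorem exists_mul_pow_eq_algebraMap_of_forall_galBmax {y : D2Cris.Bmax F p}
    (hy : ∀ σ : absoluteGaloisGroup F, D2Cris.galBmax σ y = y) :
    ∃ (n : ℕ) (x : BmaxPlus F p), y * (p : D2Cris.Bmax F p) ^ n = algebraMap (BmaxPlus F p) (D2Cris.Bmax F p) x := by
  -- `y = a / tᵏ`
  obtain ⟨k, a, e⟩ : ∃ (k : ℕ) (a : BmaxPlus F p),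
      y * algebraMap (BmaxPlus F p) (D2Cris.Bmax F p) tBmax ^ k = algebraMap (BmaxPlus F p) (D2Cris.Bmax F p) a :=
    ⟨(IsLocalization.Away.sec (tBmax (F := F) (p := p)) y).2, (IsLocalization.Away.sec (tBmax (F := F) (p := p)) y).1,
      by simpa only [map_pow] using IsLocalization.Away.sec_spec (tBmax (F := F) (p := p)) y⟩
  obtain ⟨m, b, -, hm⟩ := exists_tBmax_pow_mul_of_twisted hp hF hTC (twisted_of_forall_galBmax hp e hy)
  have hT : IsUnit (algebraMap (BmaxPlus F p) (D2Cris.Bmax F p) tBmax ^ k) :=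
    (D2Cris.isUnit_algebraMap_tBmax (F := F) (p := p)).pow k
  have hm' : a * (p : BmaxPlus F p) ^ m = tBmax ^ k * b := (mul_comm _ _).trans hm
  refine ⟨m, b, hT.mul_left_inj.1 ?_⟩
  calc y * (p : D2Cris.Bmax F p) ^ m * algebraMap (BmaxPlus F p) (D2Cris.Bmax F p) tBmax ^ k
        = y * algebraMap (BmaxPlus F p) (D2Cris.Bmax F p) tBmax ^ k * (p : D2Cris.Bmax F p) ^ m := mul_right_comm _ _ _
    _ = algebraMap (BmaxPlus F p) (D2Cris.Bmax F p) a * (p : D2Cris.Bmax F p) ^ m := congrArg (· * (p : D2Cris.Bmax F p) ^ m) e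
    _ = algebraMap (BmaxPlus F p) (D2Cris.Bmax F p) (a * (p : BmaxPlus F p) ^ m) := by
        simp only [map_mul, map_pow, map_natCast]
    _ = algebraMap (BmaxPlus F p) (D2Cris.Bmax F p) (tBmax ^ k * b) :=
        congrArg (algebraMap (BmaxPlus F p) (D2Cris.Bmax F p)) hm'
    _ = algebraMap (BmaxPlus F p) (D2Cris.Bmax F p) tBmax ^ k * algebraMap (BmaxPlus F p) (D2Cris.Bmax F p) b := by
        simp only [map_mul, map_pow]
    _ = algebraMap (BmaxPlus F p) (D2Cris.Bmax F p) b * algebraMap (BmaxPlus F p) (D2Cris.Bmax F p) tBmax ^ k :=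
        mul_comm _ _

/-! ### §4 `B_max(F)^{Γ_F} = K₀`, given (TC) -/

section Main

variable [CharP (ResidueField (integerC F)) p]
  [Fact (¬ IsUnit (p : maxUnramifiedCompletion F))] [CharP (ResidueField (maxUnramifiedCompletion F)) p]

include hp hF hTC in
/-- ★ **`B_max(F)^{Γ_F} = K₀` conditional on Colmez's criterion (TC)**: an element `y` of the constructed
`B_max(F) = A_max[1/t]` (`D2Cris.Bmax F p`) is `Γ_F`-invariant iff `y · pⁿ = ι z` for some `n` and some `Γ_F`-invariant
unramified Witt vector `z ∈ W(k̄)^{Γ_F} = W(k_F)`, i.e. iff `y ∈ K₀ = W(k_F)[1/p]`.  (Forward: the invariant is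
`p`-integral by `exists_mul_pow_eq_algebraMap_of_forall_galBmax`, then Λ3; backward: Λ3.)  This is input (I2) of the
D2-cris repair with (TC) as its only remaining hypothesis. [cite: Colmez1998Annals, §III.2–III.3]
[cite: FontaineAsterisque223III, Exp. III §4.1] -/
theorem forall_galBmax_iff_of_tCriterion (y : D2Cris.Bmax F p) :
    (∀ σ : absoluteGaloisGroup F, D2Cris.galBmax σ y = y) ↔
      ∃ (n : ℕ) (z : WittVector p (ResidueField (maxUnramifiedCompletion F))),
        (∀ σ : absoluteGaloisGroup F, WittVector.map (residueGal σ) z = z) ∧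
          y * (p : D2Cris.Bmax F p) ^ n =
            algebraMap (BmaxPlus F p) (D2Cris.Bmax F p) (ainfToBmaxPlus F p (wittToAinf F p z)) := by
  constructor
  · intro hy
    exact (forall_galBmax_iff_of_isPIntegral hp (exists_mul_pow_eq_algebraMap_of_forall_galBmax hp hF hTC hy)).1 hy
  · rintro ⟨n, z, hz, hx⟩
    exact (forall_galBmax_iff_of_isPIntegral hp ⟨n, _, hx⟩).2 ⟨n, z, hz, hx⟩

include hp hF hTC in
/-- The invariants with the witness normalised: given (TC), a `Γ_F`-invariant `y ∈ A_max[1/t]` is `y = p⁻ⁿ ι(z)` with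
`z ∈ W(k̄)^{Γ_F}`. [cite: Colmez1998Annals, §III.2–III.3] -/
theorem exists_eq_wittToAinf_of_forall_galBmax_of_tCriterion {y : D2Cris.Bmax F p}
    (hy : ∀ σ : absoluteGaloisGroup F, D2Cris.galBmax σ y = y) :
    ∃ (n : ℕ) (z : WittVector p (ResidueField (maxUnramifiedCompletion F))),
      (∀ σ : absoluteGaloisGroup F, WittVector.map (residueGal σ) z = z) ∧
        y * (p : D2Cris.Bmax F p) ^ n =
          algebraMap (BmaxPlus F p) (D2Cris.Bmax F p) (ainfToBmaxPlus F p (wittToAinf F p z)) :=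
  (forall_galBmax_iff_of_tCriterion hp hF hTC y).1 hy

end Main

end SpecC

end Summit.Langlands.Langlands.Theorems
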